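import Summits.Schanuel.Schanuel.Theses.RootDecomp1
import Summits.Schanuel.Schanuel.Theorems.RootDecomp1LadderCollapse
import Summits.Schanuel.Schanuel.Theorems.RootDecomp1EssentialInEcl
import Literature.NumberTheory.Transcendental.OneMotiveToric
import Literature.NumberTheory.Transcendental.PhilipponCriterionProofs
import Literature.NumberTheory.Transcendental.LindemannWeierstrassProofs
import Literature.Barriers.Schanuel.AlgebraicIndependenceOfLogarithms

/-!
# RootDecomp1 — THE GRADED CONE: which grades of which row the deciding theorem consumes
(cell `decomp-schanuel`, lens-1 «grading / quantitative ladder», gen 13)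

Route `RootDecomp1` (rev 22: `closes : S₂ → K → B → U⊥ → LadderCollapseGlue → Cⁿᵘ → Schanuel`)
decides Schanuel from the rows `S₂ = SchanuelTwo`, `B = DefectOneSchanuel`, `U⊥ = RationalImageSchanuel`,
`Cⁿᵘ = NonrationalSaturatedEssentialSchanuel` (+ the closed support items K and, gen 12,
`LadderCollapseGlue : B → U⊥ → L ∧ Q`, re-proved here as `ladderCollapseGlue_of_graded`).  Every row R is the conjunction of its GRADES `R = ⋀ₙ Rₙ`
(length-`n` pieces `SchanuelAt n`, `DefectOneAt n`, `LinearAt n`, `QuadraticAt n`, `RationalImageAt n`,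
`NonrationalSatEssAt n`; §0 proves the identifications with the route decls by `Iff.rfl` / binder
swaps; `RationalAt n` = U♮ₙ is gen 12's clause-free unirational row, graded).  This file determines BY
THEOREM (0 sorry) which grades are load-bearing for which conclusion.  Nothing here asserts the truth
of any row.

THEOREMS.
* §6  B-LADDER  `SchanuelAt n → DefectOneAt (n+1)` (sub-tuple monotonicity of trdeg).  Hence `B₀, B₁, B₂`
  are theorems (S₀; S₁ = Hermite–Lindemann, tree) and `S₂ → B₃`: the row B is load-bearing only from
  length 4 on — `defectOneSchanuel_of_geFour : S₂ → (∀ n ≥ 4, Bₙ) → B`.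
* §5  PADDING TRANSFERS.  (route form) for every `m ≥ n + 2`:
  `Bₙ → Bₘ → U⊥ₘ → U♮ₙ` (`rationalAt_of_higher`), and U♮ₙ gives U⊥ₙ, Lₙ, Qₙ (§2, `rows_of_higher`);
  (natural form) for every `m ≥ n`: `Bₙ → U♮ₘ → U♮ₙ` (`rationalAt_of_le`).  MECHANISM: a rational-image
  tuple `z ⊂ ℚ̄(t)` (common denominator `D`; `k = n − 1` parameters and `t` algebraically independent,
  forced by `Bₙ`, `numerics`; `k ≥ 1` by Hermite–Lindemann, `params_pos`) padded by the `j = m − n`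
  monomials `t₀^{d+1}, …, t₀^{d+j}` (`d ≥ deg Nᵢ`) stays ℚ-l.i. (`linearIndependent_pad`: a relation is
  a polynomial identity `V + W·D = 0` over ℚ̄ with `deg V ≤ d < d + 1 ≤ deg (W·D)`), is a ℚ̄-rational
  image of `k + j < m` numbers (`padded_image`), and — for `j ≥ 2`, under `Bₘ` — satisfies U⊥'s own
  clauses at length m (tight by `Bₘ`; affinely/quadratically non-degenerate by the rigid gadget
  `P^{d+2} = Q^{d+1}` on the two pads `t₀^{d+1}, t₀^{d+2}`, `pad_quadratic_clause`, `Bₘ` again).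
  COROLLARIES: `U⊥ ⟸ B ∧ (U⊥ₘ on any cofinal set of m)` (`rationalImageSchanuel_of_cofinal`, `_of_tail`),
  likewise L, Q, U♮; NO SINGLE GRADE OF U⊥ IS LOAD-BEARING — e.g. `U⊥₂ ⟸ B₂ ∧ B₄ ∧ U⊥₄` with B₂ a
  theorem (`rationalImageAt_two_of_four`): the cell «U⊥ at (n,k) = (2,1)» is removable from the cone.
* §7  GRADED DECIDING THEOREMS (the route's induction re-run with graded binders, K discharged by the
  closed item): core `schanuelAt_of_clauses : S₂ → B_{[4,n+1]} → (clauses at lengths 3…n) → Cⁿᵘ_{[3,n]}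
  → Sₙ`; route form `schanuelAt_of_graded : S₂ → B_{[4,M]} → U⊥_M → Cⁿᵘ_{[3,n]} → Sₙ` (any `M ≥ n+2`);
  natural form `schanuelAt_of_natural : S₂ → B_{[4,n+1]} → U♮_N → Cⁿᵘ_{[3,n]} → Sₙ` (any `N ≥ n`);
  first open length `schanuelAt_three : S₂ → B₄ → B₅ → U⊥₅ → Cⁿᵘ₃ → S₃` and
  `schanuelAt_three_natural : S₂ → B₄ → U♮₃ → Cⁿᵘ₃ → S₃`; globally `closes_graded`, `closes_natural`
  (cofinal U-grades suffice), `closes_cofinal` (cofinal B-grades AND cofinal U-grades suffice: the rows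
  S and B are downward monotone, §6) and `closes_via_route` (through the route's own rev-22 `closes`).

LOOK-AHEAD TABLE for deciding S at length n (read off §7):
  S₂ once · B at lengths 4 … n+1 (saturation padding, look-ahead 1 — irreducible on this line) and, in
  the route form only, also at n+2 (consumed by U⊥'s clauses at the padded length) · U at ONE length:
  ≥ n+2 in the route form (U⊥, two pads for the gadget), ≥ n in the natural form (U♮, no gadget) ·
  Cⁿᵘ at lengths 3 … n (no look-ahead; Cⁿᵘ is padding-unstable because of span-minimality).
Machinery of §§1–4 is adapted from gen 12 (`LadderCollapse.lean`, same cell), extended to common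
denominators and to `j` pads.
-/

/-!
# RootDecomp1GradedConeCore — part 1/5 of the port of lens-1 gen 13 «GRADED CONE» (route RootDecomp1 rev 22; THEOREM ROUND, critic VERDICT 2026-08-30T16:07:00Z ACCEPTED, (iii)-partial grade transfer = STRUCTURE currency; port optional-LOW (b))

§§0–2: the rows of the cone graded by the length n (SchanuelAt / DefectOneAt / RationalImageAt / RationalAt / NonrationalSatEssAt … — GRADINGS of the route rows, not route items; identifications with the route decls by Iff.rfl), polynomials over ℚ̄ ⊂ ℂ, quadratic polynomials and the rigid gadget (u^{d+1}, u^{d+2}).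

Port (census-1 gen 8) of HOME/decomp-schanuel-lens-1/g13/GradedCone.lean (sha256 abae003f…, 1137 l, 74 theorems; rc 0 against rev 22). Hygiene per the critic:
h1 the graded `def … : Prop` are GRADINGS of the rows S / B / U⊥ / U♮ / Cⁿᵘ (cell definitions of this file, not route items and not cited facts);
h2 explicit `FaithfulSMul` instance kept; h3 the §8 `example` block stays; h4 `ladderCollapseGlue_of_graded` is a plain theorem (26483 closed by p778320);
h5 advisory lint.theses-cone expected (imports Theses.RootDecomp1). Namespace `Summit.Schanuel.Schanuel.Theorems.RootDecomp1GradedCone`; statements and proofs verbatim.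
`--supports stmt-Schanuel-29644`. Sorry-free; standard axioms. Nothing here proves Schanuel; rung 0.
-/

noncomputable section

set_option linter.dupNamespace false

namespace Summit.Schanuel.Schanuel.Theorems.RootDecomp1GradedCone

open Complex IntermediateField
open scoped BigOperators
open Summit.Schanuel.Schanuel.Theses.RootDecomp1 (SchanuelTwo EssentialCounterexamplesInEcl
  DefectOneSchanuel LinearSchanuel QuadraticSchanuel RationalImageSchanuel LadderCollapseGlue
  NonrationalSaturatedEssentialSchanuel closes)
open Summit.Schanuel.Schanuel.Theorems.RootDecomp1EssentialInEcl (essentialCounterexamplesInEcl_holds)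
open Literature.NumberTheory.Transcendental (transcendental_exp_holds)
open Literature.NumberTheory.Transcendental.OneMotiveToric (trdeg_mono)
open Literature.NumberTheory.Transcendental.Philippon1986_criterion (trdeg_adjoin_range_le)
open Literature.Barriers.Schanuel (algebraicIndependent_of_le_trdeg_adjoin
  trdeg_adjoin_union_eq_of_isAlgebraic)
open Summit.Schanuel.Schanuel.Theorems.RootDecomp1LadderCollapse (Qbar quad aeval_mem_adjoin exists_nat_trdeg_range
  algCoeff_map eval_map_Qbar aeval_quad totalDegree_quad_le gadget_rigid)
open Literature.RingTheory.MvPolynomial.Ruppert (totalDegree_pow_of_ne_zero)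

/-! ## 0. The rows of the cone, graded by the length `n` -/

/-- `Sₙ`: Schanuel's inequality for ℚ-l.i. tuples of length `n` (`_root_.Schanuel = ∀ n, SchanuelAt n`;
verbatim `Literature.NumberTheory.Transcendental.SchanuelRank n`). -/
def SchanuelAt (n : ℕ) : Prop :=
  ∀ (z : Fin n → ℂ), LinearIndependent ℚ z →
    (n : Cardinal) ≤ Algebra.trdeg ℚ ↥(adjoin ℚ (Set.range z ∪ Set.range (cexp ∘ z)))

/-- `Bₙ`: one-defect Schanuel at length `n` (`DefectOneSchanuel = ∀ n, DefectOneAt n`). -/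
def DefectOneAt (n : ℕ) : Prop :=
  ∀ (z : Fin n → ℂ), LinearIndependent ℚ z →
    (n : Cardinal) ≤ Algebra.trdeg ℚ ↥(adjoin ℚ (Set.range z ∪ Set.range (cexp ∘ z))) + 1

/-- The AFFINE CLAUSE at `z` (= the conclusion of L at `z`, verbatim the route's clause). -/
def AffineClause {n : ℕ} (z : Fin n → ℂ) : Prop :=
  ∀ (k : ℕ) (t : Fin k → ℂ) (β₀ γ₀ : Fin n → ℂ) (β γ : Fin n → Fin k → ℂ),
    (∀ i, IsAlgebraic ℚ (β₀ i)) → (∀ i j, IsAlgebraic ℚ (β i j)) → (∀ i, IsAlgebraic ℚ (γ₀ i)) →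
    (∀ i j, IsAlgebraic ℚ (γ i j)) → (∀ i, z i = β₀ i + ∑ j, β i j * t j) →
    (∀ i, Complex.exp (z i) = γ₀ i + ∑ j, γ i j * t j) → n ≤ k

/-- The QUADRATIC CLAUSE at `z` (= the conclusion of Q at `z`). -/
def QuadraticClause {n : ℕ} (z : Fin n → ℂ) : Prop :=
  ∀ (k : ℕ) (t : Fin k → ℂ) (β₀ γ₀ : Fin n → ℂ) (β γ : Fin n → Fin k → ℂ)
    (δ ε : Fin n → Fin k → Fin k → ℂ),
    (∀ i, IsAlgebraic ℚ (β₀ i)) → (∀ i j, IsAlgebraic ℚ (β i j)) →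
    (∀ i j j', IsAlgebraic ℚ (δ i j j')) → (∀ i, IsAlgebraic ℚ (γ₀ i)) →
    (∀ i j, IsAlgebraic ℚ (γ i j)) → (∀ i j j', IsAlgebraic ℚ (ε i j j')) →
    (∀ i, z i = β₀ i + ∑ j, β i j * t j + ∑ j, ∑ j', δ i j j' * (t j * t j')) →
    (∀ i, Complex.exp (z i) = γ₀ i + ∑ j, γ i j * t j + ∑ j, ∑ j', ε i j j' * (t j * t j')) →
    n ≤ k

/-- TIGHTNESS of `z` (= the conclusion of B at `z`). -/
def Tight {n : ℕ} (z : Fin n → ℂ) : Prop :=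
  (n : Cardinal) ≤ Algebra.trdeg ℚ ↥(adjoin ℚ (Set.range z ∪ Set.range (cexp ∘ z))) + 1

/-- The RATIONAL CLAUSE at `z` (= the conclusion of U⊥ at `z`): `(z, e^z)` is not given by `2n`
ℚ̄-rational functions (common denominator `D`) of fewer than `n` complex parameters. -/
def RationalClause {n : ℕ} (z : Fin n → ℂ) : Prop :=
  ∀ (k : ℕ) (t : Fin k → ℂ) (D : MvPolynomial (Fin k) ℂ) (N E : Fin n → MvPolynomial (Fin k) ℂ),
    (∀ m, IsAlgebraic ℚ (MvPolynomial.coeff m D)) →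
    (∀ i m, IsAlgebraic ℚ (MvPolynomial.coeff m (N i))) →
    (∀ i m, IsAlgebraic ℚ (MvPolynomial.coeff m (E i))) →
    MvPolynomial.eval t D ≠ 0 →
    (∀ i, z i * MvPolynomial.eval t D = MvPolynomial.eval t (N i)) →
    (∀ i, Complex.exp (z i) * MvPolynomial.eval t D = MvPolynomial.eval t (E i)) → n ≤ k

/-- `Lₙ`. -/
def LinearAt (n : ℕ) : Prop := ∀ (z : Fin n → ℂ), LinearIndependent ℚ z → AffineClause z

/-- `Qₙ` (typed orthogonally to L, as in the route). -/
def QuadraticAt (n : ℕ) : Prop :=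
  ∀ (z : Fin n → ℂ), LinearIndependent ℚ z → AffineClause z → QuadraticClause z

/-- `U⊥ₙ`: the route's row `RationalImageSchanuel` at length `n`. -/
def RationalImageAt (n : ℕ) : Prop :=
  ∀ (z : Fin n → ℂ), LinearIndependent ℚ z → AffineClause z → QuadraticClause z → Tight z →
    RationalClause z

/-- `U♮ₙ`: CLAUSE-FREE unirational Schanuel at length `n` (gen 12's `RationalSchanuel`, graded). -/
def RationalAt (n : ℕ) : Prop := ∀ (z : Fin n → ℂ), LinearIndependent ℚ z → RationalClause z

/-- `Cⁿᵘₙ`: the residual `NonrationalSaturatedEssentialSchanuel` at length `n`. -/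
def NonrationalSatEssAt (n : ℕ) : Prop :=
  3 ≤ n → ∀ (z : Fin n → ℂ), LinearIndependent ℚ z →
    (∀ i, z i ∈ Literature.NumberTheory.Transcendental.ecl (∅ : Set ℂ)) →
    (∀ (m : ℕ), m < n → ∀ (w : Fin m → ℂ), LinearIndependent ℚ w →
      (∀ i, w i ∈ Submodule.span ℚ (Set.range z)) →
      (m : Cardinal) ≤ Algebra.trdeg ℚ ↥(adjoin ℚ (Set.range w ∪ Set.range (cexp ∘ w)))) →
    (∀ w : ℂ, IsAlgebraic ↥(adjoin ℚ (Set.range z ∪ Set.range (cexp ∘ z))) w →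
      IsAlgebraic ↥(adjoin ℚ (Set.range z ∪ Set.range (cexp ∘ z))) (cexp w) →
      w ∈ Submodule.span ℚ (Set.range z)) →
    AffineClause z → QuadraticClause z → RationalClause z →
    (n : Cardinal) ≤ Algebra.trdeg ℚ ↥(adjoin ℚ (Set.range z ∪ Set.range (cexp ∘ z)))

/-! ### Identification with the route decls (all by unfolding) -/

/-- `_root_.Schanuel ↔ ∀ n, SchanuelAt n`. -/
theorem schanuel_iff : _root_.Schanuel ↔ ∀ n, SchanuelAt n := Iff.rfl

/-- `SchanuelAt 2 ↔ SchanuelTwo`. -/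
theorem schanuelAt_two_iff : SchanuelAt 2 ↔ SchanuelTwo := Iff.rfl

/-- `DefectOneSchanuel ↔ ∀ n, DefectOneAt n`. -/
theorem defectOneSchanuel_iff : DefectOneSchanuel ↔ ∀ n, DefectOneAt n := Iff.rfl

/-- `LinearSchanuel ↔ ∀ n, LinearAt n`. -/
theorem linearSchanuel_iff : LinearSchanuel ↔ ∀ n, LinearAt n :=
  ⟨fun h n z hz k t β₀ γ₀ β γ => h n k z t β₀ γ₀ β γ hz,
   fun h n k z t β₀ γ₀ β γ hz => h n z hz k t β₀ γ₀ β γ⟩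

/-- `QuadraticSchanuel ↔ ∀ n, QuadraticAt n`. -/
theorem quadraticSchanuel_iff : QuadraticSchanuel ↔ ∀ n, QuadraticAt n :=
  ⟨fun h n z hz ha k t β₀ γ₀ β γ δ ε => h n k z t β₀ γ₀ β γ δ ε hz ha,
   fun h n k z t β₀ γ₀ β γ δ ε hz ha => h n z hz ha k t β₀ γ₀ β γ δ ε⟩

/-- `RationalImageSchanuel ↔ ∀ n, RationalImageAt n`. -/
theorem rationalImageSchanuel_iff : RationalImageSchanuel ↔ ∀ n, RationalImageAt n :=
  ⟨fun h n z hz ha hq ht k t D N E => h n k z t D N E hz ha hq ht,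
   fun h n k z t D N E hz ha hq ht => h n z hz ha hq ht k t D N E⟩

/-- `NonrationalSaturatedEssentialSchanuel ↔ ∀ n, NonrationalSatEssAt n`. -/
theorem nonrational_iff : NonrationalSaturatedEssentialSchanuel ↔ ∀ n, NonrationalSatEssAt n := Iff.rfl

/-- Auxiliary fact `affineClause_of_quadraticClause`: affineClause of quadraticClause. -/
theorem affineClause_of_quadraticClause {n : ℕ} (x : Fin n → ℂ) (h : QuadraticClause x) :
    AffineClause x :=
  fun k' t' β₀ γ₀ β γ hβ₀ hβ hγ₀ hγ hxr her =>
    h k' t' β₀ γ₀ β γ (fun _ _ _ => 0) (fun _ _ _ => 0) hβ₀ hβ (fun _ _ _ => isAlgebraic_zero)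
      hγ₀ hγ (fun _ _ _ => isAlgebraic_zero) (fun i => by simp [hxr i]) (fun i => by simp [her i])

/-- `RationalImageAt n`. -/
theorem rationalImageAt_of_rationalAt {n : ℕ} (h : RationalAt n) : RationalImageAt n :=
  fun z hz _ _ _ => h z hz

/-! ## 1. Polynomials and rational functions over the subalgebra `ℚ̄ ⊂ ℂ` -/

/-- If `z·D(t) = N(t)` and `e^z·D(t) = E(t)` coordinatewise, `D(t) ≠ 0`, for ℚ̄-polynomials
`D, N_i, E_i`, then `trdeg ℚ(z, e^z) ≤ trdeg ℚ(t)`. -/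
theorem trdeg_le_of_rational {n k : ℕ} (z : Fin n → ℂ) (t : Fin k → ℂ)
    (D : MvPolynomial (Fin k) Qbar) (N E : Fin n → MvPolynomial (Fin k) Qbar)
    (hD0 : MvPolynomial.aeval t D ≠ 0)
    (hzN : ∀ i, z i * MvPolynomial.aeval t D = MvPolynomial.aeval t (N i))
    (hzE : ∀ i, cexp (z i) * MvPolynomial.aeval t D = MvPolynomial.aeval t (E i)) :
    Algebra.trdeg ℚ ↥(adjoin ℚ (Set.range z ∪ Set.range (cexp ∘ z))) ≤
      Algebra.trdeg ℚ ↥(adjoin ℚ (Set.range t)) := by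
  set T : Set ℂ := {y : ℂ | IsAlgebraic ℚ y} with hT
  have hsub : Set.range z ∪ Set.range (cexp ∘ z) ⊆ (adjoin ℚ (Set.range t ∪ T) : Set ℂ) := by
    rintro x (⟨i, rfl⟩ | ⟨i, rfl⟩)
    · rw [(eq_div_iff hD0).mpr (hzN i)]
      exact div_mem (aeval_mem_adjoin t (N i)) (aeval_mem_adjoin t D)
    · simp only [Function.comp_apply]
      rw [(eq_div_iff hD0).mpr (hzE i)]
      exact div_mem (aeval_mem_adjoin t (E i)) (aeval_mem_adjoin t D)
  calc Algebra.trdeg ℚ ↥(adjoin ℚ (Set.range z ∪ Set.range (cexp ∘ z)))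
      ≤ Algebra.trdeg ℚ ↥(adjoin ℚ (Set.range t ∪ T)) := trdeg_mono (adjoin_le_iff.mpr hsub)
    _ = Algebra.trdeg ℚ ↥(adjoin ℚ (Set.range t)) :=
        trdeg_adjoin_union_eq_of_isAlgebraic (K := ℚ) (Set.range t) T (fun x hx => hx)

/-- **Numerics forced by `Bₙ`.**  If `Bₙ` holds and a ℚ-l.i. `z` of length `n > k` is (with its
exponentials) a ℚ̄-rational image of `t : Fin k → ℂ`, then `n = k + 1` and `t` is algebraically
independent over ℚ. -/
theorem numerics {n : ℕ} (hB : DefectOneAt n) {k : ℕ} (z : Fin n → ℂ) (t : Fin k → ℂ)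
    (hz : LinearIndependent ℚ z) (D : MvPolynomial (Fin k) Qbar)
    (N E : Fin n → MvPolynomial (Fin k) Qbar) (hD0 : MvPolynomial.aeval t D ≠ 0)
    (hzN : ∀ i, z i * MvPolynomial.aeval t D = MvPolynomial.aeval t (N i))
    (hzE : ∀ i, cexp (z i) * MvPolynomial.aeval t D = MvPolynomial.aeval t (E i))
    (hkn : k < n) : n = k + 1 ∧ AlgebraicIndependent ℚ t := by
  obtain ⟨m, hm, hmk⟩ := exists_nat_trdeg_range t
  have h1 := hB z hz
  have h2 := trdeg_le_of_rational z t D N E hD0 hzN hzE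
  rw [hm] at h2
  have h3 : (n : Cardinal) ≤ (m : Cardinal) + 1 := h1.trans (add_le_add h2 le_rfl)
  have h4 : n ≤ m + 1 := by exact_mod_cast h3
  have hmk' : m = k := by omega
  refine ⟨by omega, algebraicIndependent_of_le_trdeg_adjoin t ?_⟩
  have hkm : (k : Cardinal) ≤ (m : Cardinal) := by exact_mod_cast hmk'.ge
  exact hkm.trans hm.symm.le

/-- A ℂ-polynomial all of whose coefficients are algebraic is the image of a ℚ̄-polynomial. -/
theorem exists_map_eq_of_algebraic {k : ℕ} (P : MvPolynomial (Fin k) ℂ)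
    (hP : ∀ m, IsAlgebraic ℚ (MvPolynomial.coeff m P)) :
    ∃ P' : MvPolynomial (Fin k) Qbar, MvPolynomial.map (algebraMap Qbar ℂ) P' = P := by
  have h : P ∈ Set.range (MvPolynomial.map (algebraMap Qbar ℂ)) := by
    rw [MvPolynomial.mem_range_map_iff_coeffs_subset]
    intro c hc
    obtain ⟨m, -, rfl⟩ := MvPolynomial.mem_coeffs_iff.mp hc
    exact ⟨⟨_, hP m⟩, rfl⟩
  exact h

/-! ## 2. Quadratic polynomials over ℚ̄ and the rigid gadget `(u^{d+1}, u^{d+2})` -/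

/-- A quadratic (in particular an affine) parametrisation is a rational one with denominator `1`:
the rational clause implies the quadratic and the affine clause at the same `z`. -/
theorem quadraticClause_of_rationalClause {n : ℕ} (z : Fin n → ℂ) (h : RationalClause z) :
    QuadraticClause z := by
  intro k t β₀ γ₀ β γ δ ε hβ₀ hβ hδ hγ₀ hγ hε hzr her
  exact h k t (MvPolynomial.map (algebraMap Qbar ℂ) 1)
    (fun i => MvPolynomial.map (algebraMap Qbar ℂ)
      (quad ⟨β₀ i, hβ₀ i⟩ (fun a => ⟨β i a, hβ i a⟩) (fun a a' => ⟨δ i a a', hδ i a a'⟩)))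
    (fun i => MvPolynomial.map (algebraMap Qbar ℂ)
      (quad ⟨γ₀ i, hγ₀ i⟩ (fun a => ⟨γ i a, hγ i a⟩) (fun a a' => ⟨ε i a a', hε i a a'⟩)))
    (fun m => algCoeff_map _ m) (fun i m => algCoeff_map _ m) (fun i m => algCoeff_map _ m)
    (by rw [eval_map_Qbar, map_one]; exact one_ne_zero)
    (fun i => by rw [eval_map_Qbar, eval_map_Qbar, map_one, mul_one, aeval_quad]; exact hzr i)
    (fun i => by rw [eval_map_Qbar, eval_map_Qbar, map_one, mul_one, aeval_quad]; exact her i)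

/-- Auxiliary fact `affineClause_of_rationalClause`: affineClause of rationalClause. -/
theorem affineClause_of_rationalClause {n : ℕ} (z : Fin n → ℂ) (h : RationalClause z) :
    AffineClause z :=
  affineClause_of_quadraticClause z (quadraticClause_of_rationalClause z h)

/-- `U♮ₙ ⟹ Lₙ`, `U♮ₙ ⟹ Qₙ` (same length, no B; `U♮ₙ ⟹ U⊥ₙ` is `rationalImageAt_of_rationalAt`). -/
theorem linearAt_of_rationalAt {n : ℕ} (h : RationalAt n) : LinearAt n :=
  fun z hz => affineClause_of_rationalClause z (h z hz)

/-- `QuadraticAt n`. -/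
theorem quadraticAt_of_rationalAt {n : ℕ} (h : RationalAt n) : QuadraticAt n :=
  fun z hz _ => quadraticClause_of_rationalClause z (h z hz)

/-- The three clauses of the cone at `z` from the clause-free row at the SAME length. -/
theorem clauses_of_rationalAt {n : ℕ} (hU : RationalAt n) (z : Fin n → ℂ)
    (hz : LinearIndependent ℚ z) : AffineClause z ∧ QuadraticClause z ∧ RationalClause z :=
  ⟨affineClause_of_rationalClause z (hU z hz), quadraticClause_of_rationalClause z (hU z hz), hU z hz⟩

end Summit.Schanuel.Schanuel.Theorems.RootDecomp1GradedCone
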